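import Summits.HodgeConjecture.HodgeConjecture.Theorems.A3Liu418Mult1AtFace
import Summits.HodgeConjecture.CorCM.HypLiu418.A3Liu418HonestIsogenyDescent
import Summits.HodgeConjecture.HodgeConjecture.Theorems.HLiu418FaltingsOfAlbCM
import Literature.NumberTheory.Automorphic.Liu2021.AppendixC.BettiPinningAlbaneseCMType
import HarnessLib

/-!
# Line `a3-liu418`, LINE T5′ («CM-Albanese ∕ Mumford–Tate-torus road») — THE FACE: from the route item `H413` alone, every level-`K`
# Albanese `A_K ×_{τ'} ℂ` of `V`'s canonical-model tower is of CM-type, hence the `hF` binder of `faltingsIsotypic_of_isInducedBy` WITHOUT [Fal83]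

Cell `hodgecm-mathlib` (D-0151), fan A, crux item hLiu418 = stmt-HodgeConjecture-24832; LINE T5′ (A-p09 (g12) road 2026-08-29T15:21Z, A-plan1 (g12)
adoption 15:31:42Z, director s155).  PROVER FILE (seat A-p09 g12): THEOREMS ONLY, sorry-free, no definition / named fact / instance; namespace
`Summit.HodgeConjecture.CorCM.Lines.A3Liu418` (the line's).  HC_CM is proved only modulo the 7 printed citations until rung 0 closes; this
file discharges none of them (its hypotheses are the route item `H413` and the binder `hDel`; [Def 4.11] enters as the CLOSED item `H411_proof`).

WHAT IT DOES.  The registry `Cruxes/HLiu418/Lines/a3_liu418.lean` v20/v21 feeds the `hF` binder of ★ `faltingsIsotypic_of_isInducedBy`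
(`∀ K obj, faltings_tate_bijective (A_K) (A_ν,obj) ℓ`) from the fact-level residual `stub_hypEllPowerTower` (Tate's Hyp along ℓ-power towers,
[Fal83]) through R1/R2.  Here that binder is a THEOREM of `H413`:
* `isOfCMType_alb_baseChange_of_h413` — for every face `(hDel, F, ι₁, V, a, Φ)` with `ι₁ ∈ Φ` there is an embedding `τ'` (the Betti pinning's)
  such that EVERY `A_K ×_{τ'} ℂ` is of CM-type (`Milne1999.IsOfCMType`).  Proof = the generic lever ★
  `Sec42Data.BettiPinning.isOfCMType_baseChange_of_directSum_of_eq_of_equiv` (`AppendixC/BettiPinningAlbaneseCMType`: Betti level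
  descent + Hecke operators as honest endomorphisms of `A_K` from row (D) + multiplicity one ⇒ commutative Hecke commutant ⇒ Milne's lever)
  fed with: the pinned Betti theta model at the face ([Prop 4.13] = `h413`: ★ `bettiThetaModelAtPlace_of_hyp413_of_pinning` over ★
  `pinBettiPinning_of_lemma24Proj` ∘ ★ F6 at place, ★ `stubBettiThetaModelOffPlace_of_h413_of_unique_of_lemma24Proj` with ★ row I-4 off place —
  the block of ★ `etaleBettiModel_of_h413`), irreducible-or-zero summands ([Def 4.11] = ★ `isIrreducibleOrZero_rho_UV_of_hyp411 H411_proof`),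
  their separation (★ `admTripleAll_UV_eq_of_equiv`, [Lem D.1 (3)] + [Flath] + weak approximation, B-p14/A-p09 g5), and row (D)
  (★ `stubHonestIsogenyDescent_holds`).
* `hF_of_h413` — the `hF` binder itself, INSTANCE-FREE, from ★ (N9) Faltings–Tate for pairs of CM type (`faltings_tate_bijective_of_isOfCMType`,
  over ★ `shimura1998_thm18_6_holds`) through A-p04's ★ junction `hF_of_isOfCMType_alb` (the `A_ν` side is ★ `RestOne.isOfCMType_baseChange_aμOne`).
So [Liu2021, Cor. 4.20 / Thm 1.1] «`A_K` is of CM type» reaches the tree by the Mumford–Tate road (Murty–Ramakrishnan 1992 §2's route: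
Hecke correspondences as endomorphisms of `Alb` + multiplicity one) instead of print's `ℓ`-adic comparison + Faltings' isogeny theorem, and the
registry edition v22 (A-plan1) can re-wire `stub_faltingsIsotypic` through A-p03's `stubFaltingsIsotypic_of_hF (hF_of_h413 h413 …)`, letting
`stub_hypEllPowerTower`, R1, R2 and `stub_faltings_tate_bijective` leave the cone (sorries 2 → 1 = {`stub_D6`}).

## References
* [Liu2021] Y. Liu, *Fourier–Jacobi cycles and arithmetic relative trace formula*, Camb. J. Math. 9 (2021) = arXiv:2102.11518: Prop. 4.13
  (FJcycle.tex l. 2110–2131); Def. 4.11; Thm. 4.18 (1)–(2) with proof (l. 2232–2282); Def. 4.19 / Cor. 4.20 (print p. 54); Def. 4.5 (2).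
* [Milne1999] J. S. Milne, *Lefschetz motives and the Tate conjecture*, Compositio Math. 117 (1999), §1 Remark 1.10 (p. 53).
* [Shimura1998] G. Shimura, *Abelian Varieties with Complex Multiplication and Modular Functions* (1998), Thm. 18.6 (through ★ N9).
-/

set_option autoImplicit false

noncomputable section

namespace Summit.HodgeConjecture.CorCM.Lines.A3Liu418

open scoped TensorProduct Matrix DirectSum
open NumberField NumberField.InfinitePlace
open HodgeCM.Model HodgeCM.Model.LiuIndex HodgeCM.Model.TowerCarrier
open Summit.HodgeConjecture.CorCM.Model
open Literature.AlgebraicGeometry.Motives (CMType AbelianVariety faltings_tate_bijective)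
open Literature.AlgebraicGeometry.Milne1999 (IsOfCMType)
open Literature.AlgebraicGeometry.HodgeTheory Literature.NumberTheory.Automorphic.PicardCM
open Literature.AlgebraicGeometry.ShimuraVarieties.UnitaryCanonicalModel
open Literature.NumberTheory.ComplexMultiplication
open Literature.NumberTheory.Automorphic
open Literature.NumberTheory.Automorphic.Liu2021 Literature.NumberTheory.Automorphic.Liu2021.AppendixC
open Literature.NumberTheory.Automorphic.Liu2021.AppendixC.RestOne
open Literature.RepresentationTheory Literature.RepresentationTheory.Liu2021
open Summit.HodgeConjecture.CorCM.Transposition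
open Summit.HodgeConjecture.CorCM.D2Bridge
open Summit.HodgeConjecture.CorCM.D2Bridge.MuKeyIdentLemD3End
open Summit.HodgeConjecture.CorCM.D2Bridge.MuKeyIdentLemD3DelRecConjOmegaEndT
open Summit.HodgeConjecture.CorCM.D2Bridge.MuKeyIdentLemD3DelRecConjOmegaEndT.PrintedCitationHypotheses (Hyp411)

/-- **Every level-`K` Albanese of `V`'s tower is of CM type over `ℂ` (along the pinning's embedding), from the route item `H413`.**  For every
face `(hDel, F, ι₁, V, a, Φ)` with `ι₁ ∈ Φ` there is `τ' : F → ℂ` with `IsOfCMType (A_K ×_{F,τ'} ℂ)` for all small levels `K` of `V`'s §4.2 datum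
`CV hDel F V Φ`: the pinned Betti theta model at the face (`h413`; at place ∕ off place as in `etaleBettiModel_of_h413`) feeds the generic lever
`isOfCMType_baseChange_of_directSum_of_eq_of_equiv` with [Def 4.11] (`H411_proof`), label separation (`admTripleAll_UV_eq_of_equiv`) and row (D)
(`stubHonestIsogenyDescent_holds`).  = [Liu2021, Cor. 4.20] at the faces of the headline, by the Mumford–Tate road.
[cite: Liu2021, Prop. 4.13 (FJcycle.tex l. 2110–2131), Thm. 4.18 (2) (l. 2241), Cor. 4.20 (print p. 54)] [cite: Milne1999, §1 Remark 1.10 (p. 53)] -/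
theorem isOfCMType_alb_baseChange_of_h413 (h413 : Summit.HodgeConjecture.HodgeConjecture.Theses.HCCMUnconditional.H413)
    (hDel : Literature.AlgebraicGeometry.ShimuraVarieties.UnitaryCanonicalModel.canonicalModel_exists_printed)
    (F : HodgeCM.CMField) [IsGalois ℚ F] (h6 : 6 ≤ Module.finrank ℚ F) {ι₁ : F →+* ℂ} (V : HodgeCM.HermSpace3 F ι₁) (a : RealScalar F)
    (Φ : CMType F) (hΦ : ι₁ ∈ Φ.1) :
    ∃ τ' : (F : Type) →+* ℂ, ∀ K : C5.SmallLevel (CV hDel F V Φ).S.K₀,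
      letI : Algebra (F : Type) ℂ := algebraAlong (F : Type) τ'
      IsOfCMType (((CV hDel F V Φ).A K).baseChange ℂ) := by
  -- the pinned Betti theta model at this face (at place: the pin itself; off place: transported along the model isomorphism)
  have hP : ∃ (τ' : (F : Type) →+* ℂ) (H : Type) (_ : AddCommGroup H) (_ : Module ℂ H) (rhoB : Representation ℂ (CV hDel F V Φ).G H),
      Nonempty ((CV hDel F V Φ).BettiPinning (TV hDel F h6 V Φ) τ' H rhoB) ∧ BettiThetaDecomposition (UV hDel F V a Φ) H rhoB := by
    by_cases hemb : (NumberField.InfinitePlace.mk ι₁).embedding = ι₁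
    · exact bettiThetaModelAtPlace_of_hyp413_of_pinning h413
        (pinBettiPinning_of_lemma24Proj
          Literature.NumberTheory.Automorphic.Liu2021.AppendixC.albanese_bettiOne_pullback_bijective_of_isProjectiveOver)
        hDel F h6 V hemb a Φ hΦ
    · exact stubBettiThetaModelOffPlace_of_h413_of_unique_of_lemma24Proj
        Literature.NumberTheory.Automorphic.Liu2021.AppendixC.albanese_bettiOne_pullback_bijective_of_isProjectiveOver h413
        canonicalModel_unique_printed_holds hDel F h6 V hemb a Φ hΦ
  obtain ⟨τ', H, _, _, rhoB, ⟨B⟩, hdec⟩ := hP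
  -- the summands are irreducible-or-zero ([Def 4.11], closed item) and separated ([Lem D.1 (3)] road, ★)
  have hirr : ∀ t : AdmTripleAll (UV hDel F V a Φ),
      ∀ U : Subrepresentation ((UV hDel F V a Φ).rho t.μ t.hμ t.ε t.χ), U = ⊥ ∨ U = ⊤ := fun t =>
    isIrreducibleOrZero_rho_UV_of_hyp411 Summit.HodgeConjecture.HodgeConjecture.Theorems.H411_proof
      hDel F h6 V a Φ hΦ t.μ t.hμ t.hw t.ε t.χ
  have hsep : ∀ s t : AdmTripleAll (UV hDel F V a Φ), Nontrivial ((UV hDel F V a Φ).omega s.μ s.hμ s.ε s.χ) →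
      (∃ f : (UV hDel F V a Φ).omega s.μ s.hμ s.ε s.χ ≃ₗ[ℂ] (UV hDel F V a Φ).omega t.μ t.hμ t.ε t.χ,
        ∀ (g : (CV hDel F V Φ).G) (v : (UV hDel F V a Φ).omega s.μ s.hμ s.ε s.χ),
          f ((UV hDel F V a Φ).rho s.μ s.hμ s.ε s.χ g v) = (UV hDel F V a Φ).rho t.μ t.hμ t.ε t.χ g (f v)) → s = t :=
    fun s t hs hst => admTripleAll_UV_eq_of_equiv hDel F h6 V a Φ hΦ s t hs hst
  have hD := stubHonestIsogenyDescent_holds hDel F h6 V Φ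
  -- make the face family opaque BEFORE the generic lever is instantiated: with `UV …` unfolded the `exact` below exceeds 4 M heartbeats
  -- at `whnf`; generalized, the whole declaration elaborates at the default budget (B30-clean, measured)
  generalize UV hDel F V a Φ = U at hirr hsep hdec
  obtain ⟨Ψ, hΨ⟩ := hdec
  refine ⟨τ', fun K => ?_⟩
  exact B.isOfCMType_baseChange_of_directSum_of_eq_of_equiv hD (fun t => U.rho t.μ t.hμ t.ε t.χ) hirr Ψ hΨ hsep K

/-- **The `hF` binder of `faltingsIsotypic_of_isInducedBy` at every face, from `H413` — row VI-1 WITHOUT [Fal83].**  For every face, every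
conjugate-symplectic weight-one `ν`, every prime `ℓ`, every small level `K` and every object `obj` of `𝒜(ν)`:
`faltings_tate_bijective (A_K) (A_ν,obj) ℓ`, by ★ (N9) Faltings–Tate for pairs of geometric CM type (`Theorems.faltings_tate_bijective_of_isOfCMType`,
[Shimura1998, Thm 18.6] ★) through A-p04's junction `hF_of_isOfCMType_alb`, the Albanese side from `isOfCMType_alb_baseChange_of_h413` (at the
pinning's instance — the junction is instance-polymorphic) and the `A_ν` side from ★ `RestOne.isOfCMType_baseChange_aμOne`.  Instance-free
statement: exactly the binder the registry's `stub_faltingsIsotypic` consumes.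
[cite: Liu2021, Thm. 4.18 proof (FJcycle.tex l. 2245–2263), Def. 4.5 (2) (l. 1944–1950), Cor. 4.20 (print p. 54)] [cite: Shimura1998, Thm. 18.6] -/
theorem hF_of_h413 (h413 : Summit.HodgeConjecture.HodgeConjecture.Theses.HCCMUnconditional.H413)
    (hDel : Literature.AlgebraicGeometry.ShimuraVarieties.UnitaryCanonicalModel.canonicalModel_exists_printed)
    (F : HodgeCM.CMField) [IsGalois ℚ F] (h6 : 6 ≤ Module.finrank ℚ F) {ι₁ : F →+* ℂ} (V : HodgeCM.HermSpace3 F ι₁) (a : RealScalar F)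
    (Φ : CMType F) (hΦ : ι₁ ∈ Φ.1) (ν : Literature.NumberTheory.Automorphic.IdeleClassGroup (F : Type) →ₜ* Circle)
    (hν : IdeleClassGroup.IsConjugateSymplectic (F : Type) ν) (hw : IdeleClassGroup.HasWeight (F : Type) ν 1) (ℓ : ℕ) [Fact ℓ.Prime] :
    ∀ (K : C5.SmallLevel (CV hDel F V Φ).S.K₀) (obj : ObjOne (AlgHom.id ℚ (F : Type)) ι₁ hν hw (CarN F ι₁ ν hν)),
      faltings_tate_bijective ((CV hDel F V Φ).A K) (AμOne (AlgHom.id ℚ (F : Type)) ι₁ hν hw (CarN F ι₁ ν hν) obj) ℓ := by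
  obtain ⟨τ', halb⟩ := isOfCMType_alb_baseChange_of_h413 h413 hDel F h6 V a Φ hΦ
  letI : Algebra (F : Type) ℂ := algebraAlong (F : Type) τ'
  exact Summit.HodgeConjecture.HodgeConjecture.Theorems.hF_of_isOfCMType_alb (CV hDel F V Φ) (AlgHom.id ℚ (F : Type)) ι₁ hν hw
    (CarN F ι₁ ν hν) halb ℓ

end Summit.HodgeConjecture.CorCM.Lines.A3Liu418

end
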